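import Summits.ResolutionOfSingularities.ResolutionOfSingularities.Theorems.WildQuotientsSummitReductionStubPairOrbitNormalFormBlowupLemmas
import Summits.ResolutionOfSingularities.ResolutionOfSingularities.Theorems.WildQuotientsSummitReductionStubPairOrbitNormalFormBlowupLemmas2
import Summits.ResolutionOfSingularities.ResolutionOfSingularities.Theorems.WildQuotientsSummitReductionStubPairOrbitNormalFormBlowupLemmas3
import HarnessLib

/-!
# `WildQuotients.SummitReduction` (stmt-ResolutionOfSingularities-16324), line `FramePerfect`, stub S
# (`stub_pair_orbitNormalFormBlowup`): the stub from the chart computation over the centre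

Route `ResolutionOfSingularities/WildQuotients`, crux `SummitReduction`; helper file of the line
skeleton (v8), stub S = **the orbit version of de Jong 1996, Claim 4.27** for
`DeJong1997.QuasiSplitNormalFormPair` (de Jong 1997, proof of Prop. 5.11 ¶3, p. 619: "Thus we
blow up in orbits of components of the singular locus of `X`. The resulting scheme has a local
description as above by the computations of [1, 4.27]").

De Jong 1996, 4.27 (pp. 75–76) proves the Claim in two printed parts: [C1] "Before we give some
computations, let us describe the singular locus of `X'`. Let `E' ⊂ X` be another irreducible
component of the singular locus of `X`. Let `Ẽ' ⊂ X'` be the strict transform of `E'`. This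
equals the blowing up of `E'` in the nonsingular closed subscheme `E' ∩ E` (scheme-theoretically),
hence `Ẽ'` is nonsingular. Then `Sing(X')` is the union of the `Ẽ'` so obtained." and [C2] the
chart computation ("We blow up the scheme `Spec k⟦u, v, t₁, …, t_{d-1}⟧/(uv - t₁ ⋯ t_s)` in the
ideal `(u, v, t₁, t₂)` …"). Both are LOCAL OVER THE CENTRE; everything else is bookkeeping, and
this file proves the bookkeeping for the equivariant, coefficient-free situation:

* `quasiSplitNormalFormPair_blowup_of_overCentre` — the conclusion of the stub
  (`QuasiSplitNormalFormPair (π ≫ p) (π⁻¹ Z) ρ' d` and `#Sing X' < #Sing X` on irreducible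
  components) for an equivariant projective blow-up `π` of a `QuasiSplitNormalFormPair` over a
  perfect field in the orbit closure `C` of a singular component `E`, FROM the three statements at
  the points of `X'` over `C` whose printed proof is the chart computation: (O1) a point over `C`
  is singular iff it lies on the strict transform of a component `E' ⊄ C` of `Sing X`; (O2) the
  strict transform of the orbit of such an `E'`, reduced, is a regular scheme; (O3) fields 4.25
  (i)/(ii) of the structure for `(X', π⁻¹ Z)` at the closed points over `C`.

The proof combines the three sibling helper files: the centre is the non-empty union `⋃₀ 𝒪` of
the translates of `E`, components of `Sing X` (`…Lemmas`: `componentsIn_orbit_eq`,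
`subset_orbit_iff_eq_translate`); off `π⁻¹ C` the blow-up changes nothing and `Sing X'` is the
union of the strict transforms of the components `∉ 𝒪` (`…Lemmas3`:
`singularLocus_eq_biUnion_strictTransformSet_of_overCentre`, `quasiSplitNormalFormPair_isSNCIdeal_of_notMem`,
`quasiSplitNormalFormPair_exists_ringEquiv_of_notMem`); these strict transforms are the components
of `Sing X'`, fewer by `#𝒪 ≥ 1` (`…Lemmas2`: `ncard_irreducibleComponents_lt_of_sUnion`); and the
`ρ'`-orbit of a strict transform is the strict transform of the `ρ`-orbit (`…Lemmas3`:
`closure_iUnion_image_strictTransformSet_eq_of_comm`), to which (O2) applies.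

## Sources

* A. J. de Jong, *Smoothness, semi-stability and alterations*, Publ. Math. IHÉS 83 (1996),
  4.25–4.27, pp. 75–76. [DeJong1996]
* A. J. de Jong, *Families of curves and alterations*, Ann. Inst. Fourier 47 (1997), proof of
  Prop. 5.11, p. 619. [DeJong1997]
-/

set_option linter.dupNamespace false -- the tree's summit namespace repeats `ResolutionOfSingularities`

noncomputable section

open CategoryTheory CategoryTheory.Limits AlgebraicGeometry TopologicalSpace Topology
open Literature.AlgebraicGeometry.Resolution
open Literature.AlgebraicGeometry
open IsLocalRing Scheme.IdealSheafData

namespace Summit.ResolutionOfSingularities.ResolutionOfSingularities.Theorems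

/-- **The orbit version of de Jong 1996, Claim 4.27, from its parts over the centre** (de Jong
1997, 5.11 ¶3: "Thus we blow up in orbits of components of the singular locus of `X`. The
resulting scheme has a local description as above by the computations of [1, 4.27]"). Let
`(X, Z, ρ, d)` be a `QuasiSplitNormalFormPair` over a perfect field, `E` an irreducible component
of `Sing X`, `C = closure (⋃_g ρ(g)(E))` the orbit centre, `π : X' → X` a blow-up in the reduced
ideal sheaf of `C` with a lifted action `ρ'` and `X'` projective. ASSUME the three statements
whose printed proof is the chart computation of [1, 4.27] at the closed points OVER `C`:
(O1) a point `x'` over `C` is singular on `X'` iff it lies on the strict transform of a component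
`E' ⊄ C` of `Sing X`; (O2) for such `E'` the strict transform of its orbit `⋃_g ρ(g)(E')`, with
its reduced structure, is a regular scheme; (O3) at the closed points over `C`, the completed
ideal of `π⁻¹ Z` has local strict normal crossings data at the regular ones in `π⁻¹ Z`, and
`(𝒪̂_{X',x'}, Î_{π⁻¹Z}) ≅ (A⟦u,v⟧/(uv - t₁ ⋯ t_s), (t₁ ⋯ t_r))` at the singular ones. THEN
`(X', π⁻¹ Z, ρ', d)` is a `QuasiSplitNormalFormPair` with fewer singular components. Proof:
`C` is the union of the non-empty family `𝒪` of translates of `E`, components of `Sing X`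
(`componentsIn_orbit_eq`), and `π` is an isomorphism off `C`; so `Sing X'` is the union of the
strict transforms of the components `∉ 𝒪` (`singularLocus_eq_biUnion_strictTransformSet_of_overCentre`
with (O1)), these are its components and their number is `#Sing X - #𝒪 < #Sing X`
(`ncard_irreducibleComponents_lt_of_sUnion`); the `ρ'`-orbit of such a component is the strict
transform of a `ρ`-orbit (`closure_iUnion_image_strictTransformSet_eq_of_comm`), regular by
(O2); 4.25 (i)/(ii) upstairs hold off `C` by transport (`quasiSplitNormalFormPair_isSNCIdeal_of_notMem`,
`quasiSplitNormalFormPair_exists_ringEquiv_of_notMem`) and over `C` by (O3); `X'` is integral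
(`IsBlowup.isIntegral`), of dimension `d`, projective (given), `π⁻¹ Z` is closed and the support
of an effective Cartier divisor, and `Sing X'` is closed (`X'` of finite type over the perfect
`k`). [cite: DeJong1996, 4.26–4.27, pp. 75–76] [cite: DeJong1997, proof of Prop. 5.11, p. 619] -/
theorem quasiSplitNormalFormPair_blowup_of_overCentre (k : Type) [Field k] [PerfectField k]
    (G : Type) [Group G] [Finite G] (X : Scheme.{0}) (p : X ⟶ Spec (.of k)) (ρ : G →* Aut X)
    (Z : Set X) (d : ℕ) (hP : DeJong1997.QuasiSplitNormalFormPair p Z ρ d)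
    (E : Set ↥({x : X | ¬ IsRegularLocalRing (X.presheaf.stalk x)} : Set X))
    (hE : E ∈ irreducibleComponents ↥({x : X | ¬ IsRegularLocalRing (X.presheaf.stalk x)} : Set X))
    (X' : Scheme.{0}) (π : X' ⟶ X) (ρ' : G →* Aut X')
    (hπ : IsBlowup π (Scheme.IdealSheafData.vanishingIdeal
      ⟨closure (⋃ g : G, (ρ g).hom.base '' (Subtype.val '' E)), isClosed_closure⟩))
    (hπG : ∀ g : G, (ρ' g).hom ≫ π = π ≫ (ρ g).hom)
    (hproj' : Motives.IsProjectiveOver (Over.mk (π ≫ p)))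
    (hO1 : ∀ x' : X', π.base x' ∈ closure (⋃ g : G, (ρ g).hom.base '' (Subtype.val '' E)) →
      (¬ IsRegularLocalRing (X'.presheaf.stalk x') ↔
        ∃ E' ∈ componentsIn ({x : X | ¬ IsRegularLocalRing (X.presheaf.stalk x)} : Set X),
          ¬ E' ⊆ closure (⋃ g : G, (ρ g).hom.base '' (Subtype.val '' E)) ∧
            x' ∈ strictTransformSet π (closure (⋃ g : G, (ρ g).hom.base '' (Subtype.val '' E))) E'))
    (hO2 : ∀ E' ∈ componentsIn ({x : X | ¬ IsRegularLocalRing (X.presheaf.stalk x)} : Set X),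
      ¬ E' ⊆ closure (⋃ g : G, (ρ g).hom.base '' (Subtype.val '' E)) →
        Scheme.IsRegular (Scheme.IdealSheafData.vanishingIdeal
          ⟨strictTransformSet π (closure (⋃ g : G, (ρ g).hom.base '' (Subtype.val '' E)))
              (⋃ g : G, (ρ g).hom.base '' E'),
            strictTransformSet.isClosed π _ _⟩).subscheme)
    (hO3i : ∀ x' : X', IsClosed ({x'} : Set X') → ∀ [IsRegularLocalRing (X'.presheaf.stalk x')],
      x' ∈ π.base ⁻¹' Z → π.base x' ∈ closure (⋃ g : G, (ρ g).hom.base '' (Subtype.val '' E)) →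
        ∀ (U : X'.affineOpens) (hU : x' ∈ (U : X'.Opens)),
          IsSNCIdeal (completedStalkIdeal (Scheme.IdealSheafData.vanishingIdeal
            ⟨π.base ⁻¹' Z, hP.isClosed.preimage π.continuous⟩) x' U hU))
    (hO3ii : ∀ x' : X', IsClosed ({x'} : Set X') → ¬ IsRegularLocalRing (X'.presheaf.stalk x') →
      π.base x' ∈ closure (⋃ g : G, (ρ g).hom.base '' (Subtype.val '' E)) →
        ∃ (A : Type) (_ : CommRing A) (_ : IsRegularLocalRing A) (t : Fin (d - 1) → A) (s r : ℕ),
          Ideal.span (Set.range t) = IsLocalRing.maximalIdeal A ∧ ringKrullDim A = (d - 1 : ℕ) ∧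
          2 ≤ s ∧ s ≤ r ∧ r ≤ d - 1 ∧
          ∃ e : AdicCompletion (IsLocalRing.maximalIdeal (X'.presheaf.stalk x'))
              (X'.presheaf.stalk x') ≃+*
              DeJong1996.NodeDeformationRing A
                (∏ i ∈ Finset.univ.filter (fun i : Fin (d - 1) => i.val < s), t i),
            ∀ (U : X'.affineOpens) (hU : x' ∈ (U : X'.Opens)),
              (completedStalkIdeal (Scheme.IdealSheafData.vanishingIdeal
                  ⟨π.base ⁻¹' Z, hP.isClosed.preimage π.continuous⟩) x' U hU).map e.toRingHom =
                Ideal.span {DeJong1996.NodeDeformationRing.ofBase A _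
                  (∏ i ∈ Finset.univ.filter (fun i : Fin (d - 1) => i.val < r), t i)}) :
    DeJong1997.QuasiSplitNormalFormPair (π ≫ p) (π.base ⁻¹' Z) ρ' d ∧
      (irreducibleComponents
          ↥({x : X' | ¬ IsRegularLocalRing (X'.presheaf.stalk x)} : Set X')).ncard <
        (irreducibleComponents
          ↥({x : X | ¬ IsRegularLocalRing (X.presheaf.stalk x)} : Set X)).ncard := by
  -- the singular locus `S`, the component `E₀ = E ⊆ X` and the family `𝒪` of its translates
  have hS : IsClosed ({x : X | ¬ IsRegularLocalRing (X.presheaf.stalk x)} : Set X) :=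
    hP.isClosed_setOf_not_isRegularLocalRing
  have hE₀ : Subtype.val '' E ∈
      componentsIn ({x : X | ¬ IsRegularLocalRing (X.presheaf.stalk x)} : Set X) :=
    componentsIn.image_val_mem hE
  set E₀ : Set X := Subtype.val '' E with hE₀def
  have hE₀c : IsClosed E₀ := componentsIn.isClosed hS hE₀
  set 𝒪 : Set (Set X) := Set.range fun g : G => (ρ g).hom.base '' E₀ with h𝒪def
  have h𝒪 : 𝒪 ⊆ componentsIn ({x : X | ¬ IsRegularLocalRing (X.presheaf.stalk x)} : Set X) := by
    rintro _ ⟨g, rfl⟩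
    exact image_mem_componentsIn_singularLocus ρ g hE₀
  have h𝒪ne : 𝒪.Nonempty := ⟨_, 1, rfl⟩
  have hfin : (componentsIn ({x : X | ¬ IsRegularLocalRing (X.presheaf.stalk x)} : Set X)).Finite := by
    haveI := hP.isNoetherian
    exact componentsIn.finite _
  have hCeq : closure (⋃ g : G, (ρ g).hom.base '' E₀) = ⋃₀ 𝒪 := by
    rw [closure_orbit_eq_iUnion ρ hE₀c, Set.sUnion_range]
  have hUeq : (⋃ g : G, (ρ g).hom.base '' E₀) = ⋃₀ 𝒪 := (Set.sUnion_range _).symm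
  have hCc : IsClosed (⋃₀ 𝒪) := hUeq ▸ isClosed_iUnion_image ρ hE₀c
  -- a component lies in the centre iff it is a translate
  have hmem𝒪 : ∀ {E' : Set X},
      E' ∈ componentsIn ({x : X | ¬ IsRegularLocalRing (X.presheaf.stalk x)} : Set X) →
        (E' ⊆ ⋃₀ 𝒪 ↔ E' ∈ 𝒪) := fun hE' => by
    rw [← hUeq, subset_orbit_iff_eq_translate ρ hS hE₀ hE']
    rfl
  -- the centre is `ρ`-stable
  have hCstab : ∀ g : G, (ρ g).hom.base '' (⋃₀ 𝒪) = ⋃₀ 𝒪 := fun g => by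
    rw [← hUeq]
    exact image_iUnion_image_eq ρ E₀ g
  -- rewrite the centre everywhere as `⋃₀ 𝒪`
  have hJ := hP.vanishingIdeal_orbit_ne_bot E
  have hCl : (⟨closure (⋃ g : G, (ρ g).hom.base '' E₀), isClosed_closure⟩ : Closeds X) =
      ⟨⋃₀ 𝒪, hCc⟩ := Closeds.ext hCeq
  rw [hCl] at hπ hJ
  rw [hCeq] at hO1 hO2 hO3i hO3ii
  -- generalities on the blow-up
  haveI := hP.isIntegral
  haveI := hP.locallyOfFiniteType
  haveI : IsNoetherian X := hP.isNoetherian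
  haveI : IsIntegral X' := hπ.isIntegral hJ
  haveI : IsProper π := hπ.isProper
  haveI : IsIso (π ∣_ ⟨(⋃₀ 𝒪)ᶜ, hCc.isOpen_compl⟩) :=
    DeJong1996.NormalFormPair.isIso_morphismRestrict_compl_of_isBlowup ⟨⋃₀ 𝒪, hCc⟩ hπ
  -- [C1]: the singular locus of `X'`
  have hsing : ({x : X' | ¬ IsRegularLocalRing (X'.presheaf.stalk x)} : Set X') =
      ⋃ E' ∈ componentsIn ({x : X | ¬ IsRegularLocalRing (X.presheaf.stalk x)} : Set X) \ 𝒪,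
        strictTransformSet π (⋃₀ 𝒪) E' := by
    refine singularLocus_eq_biUnion_strictTransformSet_of_overCentre π hS hCc fun x' hx' => ?_
    rw [hO1 x' hx']
    constructor
    · rintro ⟨E', hE', hsub, hx⟩
      exact ⟨E', hE', fun hm => hsub ((hmem𝒪 hE').mpr hm), hx⟩
    · rintro ⟨E', hE', hm, hx⟩
      exact ⟨E', hE', fun hsub => hm ((hmem𝒪 hE').mp hsub), hx⟩
  have hS'c : IsClosed ({x : X' | ¬ IsRegularLocalRing (X'.presheaf.stalk x)} : Set X') :=
    DeJong1996.NormalFormPair.isClosed_setOf_not_isRegularLocalRing_of_locallyOfFiniteType (π ≫ p)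
  have hcomp := componentsIn_eq_image_strictTransformSet_of_sUnion π hS hfin h𝒪 hsing
  refine ⟨⟨inferInstance, hproj', quasiSplitNormalFormPair_topologicalKrullDim_eq_of_isBlowup hP hJ hπ,
    hP.isClosed.preimage π.continuous,
    quasiSplitNormalFormPair_exists_isEffectiveCartier_preimage hP hπ, ?_, ?_, hS'c, ?_⟩,
    ncard_irreducibleComponents_lt_of_sUnion π hS hfin h𝒪 h𝒪ne hsing⟩
  · -- 4.25 (i) upstairs
    intro x' hx'c _ hx'Z U hU
    by_cases hx : π.base x' ∈ ⋃₀ 𝒪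
    · exact hO3i x' hx'c hx'Z hx U hU
    · exact quasiSplitNormalFormPair_isSNCIdeal_of_notMem hP ⟨⋃₀ 𝒪, hCc⟩ hπ hx'c ‹_› hx'Z hx U hU
  · -- 4.25 (ii) upstairs
    intro x' hx'c hsing'
    by_cases hx : π.base x' ∈ ⋃₀ 𝒪
    · exact hO3ii x' hx'c hsing' hx
    · exact quasiSplitNormalFormPair_exists_ringEquiv_of_notMem hP ⟨⋃₀ 𝒪, hCc⟩ hπ hx'c hsing' hx
  · -- the orbits of the new singular components are strict transforms of orbits, regular by (O2)
    intro E'' hE''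
    have hmem : Subtype.val '' E'' ∈
        componentsIn ({x : X' | ¬ IsRegularLocalRing (X'.presheaf.stalk x)} : Set X') :=
      componentsIn.image_val_mem hE''
    rw [hcomp] at hmem
    obtain ⟨E', hE', hE'eq⟩ := hmem
    have hnot : ¬ E' ⊆ ⋃₀ 𝒪 := fun hsub => hE'.2 ((hmem𝒪 hE'.1).mp hsub)
    have hcl : closure (⋃ g : G, (ρ' g).hom.base '' (Subtype.val '' E'')) =
        strictTransformSet π (⋃₀ 𝒪) (⋃ g : G, (ρ g).hom.base '' E') := by
      rw [← hE'eq]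
      exact closure_iUnion_image_strictTransformSet_eq_of_comm ρ ρ' π hπG hCstab E'
    have : (⟨closure (⋃ g : G, (ρ' g).hom.base '' (Subtype.val '' E'')), isClosed_closure⟩ :
        Closeds X') =
        ⟨strictTransformSet π (⋃₀ 𝒪) (⋃ g : G, (ρ g).hom.base '' E'),
          strictTransformSet.isClosed π _ _⟩ :=
      Closeds.ext hcl
    rw [this]
    exact hO2 E' hE'.1 hnot

end Summit.ResolutionOfSingularities.ResolutionOfSingularities.Theorems

end
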